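import Literature.Combinatorics.StablePolynomials.RightHalfPlaneStabilityPreservers
import Literature.Combinatorics.StablePolynomials.MasterCompositionMultivariate
import HarnessLib

/-!
# Stability preservers for the open unit disk (Borcea–Brändén II, Theorem 3.2, `C = 𝔻`;
# part I, §6.1: Möbius substitutions, Lemma 6.2 and Theorem 6.3 for `C_1 = ⋯ = C_n = 𝔻`)

J. Borcea, P. Brändén, *The Lee–Yang and Pólya–Schur programs. II.*, Comm. Pure Appl. Math. 62 (2009)
1595–1631 (arXiv:0809.3087), §3:

> **Theorem 3.2.** Let `κ ∈ ℕⁿ`, `T : ℂ_κ[z_1,…,z_n] → ℂ[z_1,…,z_n]` be a linear operator, and `C = 𝔻` or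
> `H_{π/2}`. Then `T` preserves `C`-stability if and only if
> (a) `T` has range of dimension at most one and is of the form `T(f) = α(f)P`, where `α` is a linear
> functional on `ℂ_κ[z_1,…,z_n]` and `P` is a `C`-stable polynomial, or
> (b) the polynomial (in `2n` variables) `T[(1+zw)^κ] := Σ_{α ≤ κ} binom(κ,α) T(z^α) w^α` is `C`-stable.

Part I (Invent. Math. 177 (2009), arXiv:0809.0401), §6.1, proves this for products of arbitrary open circular
domains (Theorem 6.3) by transporting Theorem 1.1 (the case `Hⁿ`) along the linear substitutions

> `Φ_κ(f)(z_1,…,z_n) = (c_1 z_1 + d_1)^{κ_1} ⋯ (c_n z_n + d_n)^{κ_n} f(φ_1(z_1),…,φ_n(z_n))`,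
> `φ_i(ζ) = (a_i ζ + b_i)/(c_i ζ + d_i)`                                                        (6.2)–(6.3)

(Lemma 6.2: `Φ_κ` restricts to a bijection between the `Hⁿ`-stable and the `C_1 × ⋯ × C_n`-stable polynomials
of `ℂ_κ`), and Remark 6.1 notes that for `C_i = 𝔻` the symbol of Theorem 6.3 (b) is a constant multiple of
`T[(1+zw)^κ]`.

This file carries this out for the open unit disk `𝔻` (all `φ_i` equal; the case `C = H_{π/2}` is
`RightHalfPlaneStabilityPreservers.lean`): `𝔻`-stability (`IsDiskStable`), the Möbius substitution `Φ_κ` as a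
linear map (`mobiusSubst κ a b c d`, one Möbius map for all variables) with its evaluation formula (6.3) and
degree bound, the maps `φ(z) = (z+i)/(iz+1) : 𝔻 → H` and `ψ(ζ) = (ζ-i)/(-iζ+1) : H → 𝔻`, Lemma 6.2 for
`𝔻ⁿ ↔ Hⁿ` (`IsUpperHalfPlaneStable.isDiskStable_mobiusSubst`, `IsDiskStable.isUpperHalfPlaneStable_mobiusSubst`,
`mobiusSubst_phi_psi`), and Theorem 3.2 for `C = 𝔻` and every `κ ∈ ℕⁿ`
(`BorceaBranden_diskStabilityPreserver_iff`), proved as in part I: conjugate `T` to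
`T' = Ψ_γ ∘ T ∘ Φ_κ` (`γ` with `T(ℂ_κ) ⊆ ℂ_γ`), apply Theorem 1.1 for `Hⁿ`
(`BorceaBranden_stabilityPreserver_iff'`), and identify the symbol through
`Φ_κ[(z+w)^κ] = Π_i (i + w_i)^{κ_i} (1 + ψ(w_i) z_i)^{κ_i}`.

-- TODO(general form): distinct circular domains `C_i` per coordinate and non-convex `C_i` (exteriors of disks,
-- with the classes `N_κ`) as in part I Lemma 6.1, Lemma 6.2 and Theorem 6.3.

## Contents

* §1 `IsDiskStable`, `isDiskStable_smul_iff`, `isUpperHalfPlaneStable_smul_iff`.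
* §2 `mobius`; the maps `φ = mobius 1 i i 1`, `ψ = mobius 1 (-i) (-i) 1` and their identities.
* §3 `mobiusTerm`, `mobiusSubst` (`Φ_κ`): `mobiusSubst_monomial`, `mobiusSubst_prod_X_pow`,
  `mobiusSubst_eq_sum_box`, `degreeOf_mobiusSubst_le`, `eval_mobiusSubst` ((6.3)),
  `mobiusSubst_prod_X_add_C_pow`, `mobiusSubst_phi_psi`.
* §4 Lemma 6.2 (`𝔻ⁿ ↔ Hⁿ`).
* §5 `rangeBound`, `isDiskStable_boundedDegreeSymbolD_iff`, **`BorceaBranden_diskStabilityPreserver_iff`**.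

## References

* [BorceaBranden2009II] J. Borcea, P. Brändén, Comm. Pure Appl. Math. 62 (2009) 1595–1631, §3 Thm 3.2.
* [BorceaBranden2009] J. Borcea, P. Brändén, Invent. Math. 177 (2009) 541–569, §6.1 (6.1)–(6.3), Lemma 6.2,
  Thm 6.3, Remark 6.1.
-/

noncomputable section

open MvPolynomial Finset

open Complex (I normSq)

namespace Literature.Combinatorics.StablePolynomials

/-! ## §1 `𝔻`-stability -/

section Disk

variable {σ : Type*}

/-- **`𝔻`-stable**: `p(z) ≠ 0` whenever all `|z_i| < 1` ("`f` is `Ω`-stable if `f(z) ≠ 0` on `Ωⁿ`", with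
`Ω = 𝔻` the open unit disk). [cite: BorceaBranden2009II, §1 (definition of `Ω`-stable) and §3 Thm 3.2
(`C = 𝔻`)] [cite: BorceaBranden2009, §6.1 (`C_1 × ⋯ × C_n`-stable)] -/
def IsDiskStable (p : MvPolynomial σ ℂ) : Prop :=
  ∀ z : σ → ℂ, (∀ i, ‖z i‖ < 1) → eval z p ≠ 0

/-- Unfolding `IsDiskStable`. [cite: BorceaBranden2009II, §1] -/
theorem isDiskStable_iff (p : MvPolynomial σ ℂ) :
    IsDiskStable p ↔ ∀ z : σ → ℂ, (∀ i, ‖z i‖ < 1) → eval z p ≠ 0 :=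
  Iff.rfl

/-- A non-zero constant is `𝔻`-stable. [cite: BorceaBranden2009II, §1] -/
theorem isDiskStable_C {c : ℂ} (hc : c ≠ 0) : IsDiskStable (C c : MvPolynomial σ ℂ) :=
  fun z _ => by rwa [eval_C]

/-- `𝔻`-stability is unchanged by a non-zero scalar. [cite: BorceaBranden2009II, §1] -/
theorem isDiskStable_smul_iff {c : ℂ} (hc : c ≠ 0) {p : MvPolynomial σ ℂ} :
    IsDiskStable (c • p) ↔ IsDiskStable p := by
  simp only [IsDiskStable, smul_eval, mul_ne_zero_iff, hc, ne_eq, not_false_eq_true, true_and]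

/-- Stability is unchanged by a non-zero scalar. [cite: BorceaBranden2009, §1 (stable polynomials)] -/
theorem isUpperHalfPlaneStable_smul_iff {c : ℂ} (hc : c ≠ 0) {p : MvPolynomial σ ℂ} :
    IsUpperHalfPlaneStable (c • p) ↔ IsUpperHalfPlaneStable p := by
  simp only [IsUpperHalfPlaneStable, smul_eval, mul_ne_zero_iff, hc, ne_eq, not_false_eq_true, true_and]

end Disk

/-! ## §2 Möbius maps; `φ : 𝔻 → H` and `ψ : H → 𝔻` -/

section Mobius

/-- **The Möbius transformation `φ(ζ) = (aζ+b)/(cζ+d)`.** [cite: BorceaBranden2009, §6.1 eq. (6.1)] -/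
def mobius (a b c d z : ℂ) : ℂ :=
  (a * z + b) / (c * z + d)

/-- `φ(z) = (z+i)/(iz+1)`. [cite: BorceaBranden2009, §6.1 (an open circular domain is the image of `H` under a
Möbius transformation)] -/
theorem mobius_phi (z : ℂ) : mobius 1 I I 1 z = (z + I) / (I * z + 1) := by
  rw [mobius, one_mul]

/-- `ψ(ζ) = (ζ-i)/(-iζ+1)`. [cite: BorceaBranden2009, §6.1] -/
theorem mobius_psi (ζ : ℂ) : mobius 1 (-I) (-I) 1 ζ = (ζ + -I) / (-I * ζ + 1) := by
  rw [mobius, one_mul]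

/-- `iz + 1 = i(z - i)`. [cite: BorceaBranden2009, §6.1] -/
private theorem I_mul_add_one_eq (z : ℂ) : I * z + 1 = I * (z - I) := by
  rw [mul_sub, Complex.I_mul_I, sub_neg_eq_add]

/-- `iz + 1 ≠ 0` for `z ≠ i` (the pole of `φ` is `i ∉ 𝔻`). [cite: BorceaBranden2009, §6.1 proof of Lemma 6.2
("`cz+d ≠ 0` for all `z ∈ H`" / in `C_1`)] -/
theorem I_mul_add_one_ne_zero {z : ℂ} (hz : z ≠ I) : I * z + 1 ≠ 0 := by
  rw [I_mul_add_one_eq]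
  exact mul_ne_zero Complex.I_ne_zero (sub_ne_zero.2 hz)

/-- Points of `𝔻` are not the pole `i`. [cite: BorceaBranden2009, §6.1] -/
theorem ne_I_of_norm_lt_one {z : ℂ} (hz : ‖z‖ < 1) : z ≠ I := fun h => by
  rw [h, Complex.norm_I] at hz
  exact lt_irrefl _ hz

/-- `-iζ + 1 ≠ 0` for `ζ ∈ H` (the pole of `ψ` is `-i ∉ H`). [cite: BorceaBranden2009, §6.1 proof of Lemma 6.2] -/
theorem neg_I_mul_add_one_ne_zero {ζ : ℂ} (hζ : 0 < ζ.im) : -I * ζ + 1 ≠ 0 := fun h => by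
  have h' := congrArg Complex.re h
  simp only [Complex.add_re, Complex.mul_re, Complex.neg_re, Complex.I_re, Complex.I_im,
    Complex.one_re, Complex.zero_re, zero_mul, zero_sub, neg_mul, neg_neg, one_mul] at h'
  linarith

/-- **`φ` maps `𝔻` into `H`**: `Im φ(z) = (1 - |z|²)/|iz+1|² > 0`. [cite: BorceaBranden2009, §6.1 ("an open
circular domain is the image of `H` under a Möbius transformation, i.e., an open disk …")] -/
theorem im_mobius_phi_pos {z : ℂ} (hz : ‖z‖ < 1) : 0 < (mobius 1 I I 1 z).im := by
  have hn : z.re * z.re + z.im * z.im < 1 := by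
    rw [← Complex.normSq_apply, Complex.normSq_eq_norm_sq]
    nlinarith [norm_nonneg z]
  have hv : I * z + 1 ≠ 0 := I_mul_add_one_ne_zero (ne_I_of_norm_lt_one hz)
  rw [mobius_phi, Complex.div_im, ← sub_div]
  refine div_pos ?_ (Complex.normSq_pos.2 hv)
  simp only [Complex.add_re, Complex.add_im, Complex.mul_re, Complex.mul_im, Complex.I_re, Complex.I_im,
    Complex.one_re, Complex.one_im, zero_mul, one_mul, zero_sub, zero_add, add_zero]
  nlinarith [hn]

/-- **`ψ` maps `H` into `𝔻`**: `|ζ - i| < |ζ + i|` for `Im ζ > 0`. [cite: BorceaBranden2009, §6.1] -/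
theorem norm_mobius_psi_lt_one {ζ : ℂ} (hζ : 0 < ζ.im) : ‖mobius 1 (-I) (-I) 1 ζ‖ < 1 := by
  have hv : -I * ζ + 1 ≠ 0 := neg_I_mul_add_one_ne_zero hζ
  rw [mobius_psi, norm_div, div_lt_one (norm_pos_iff.2 hv)]
  refine lt_of_pow_lt_pow_left₀ 2 (norm_nonneg _) ?_
  rw [Complex.sq_norm, Complex.sq_norm, Complex.normSq_apply, Complex.normSq_apply]
  simp only [Complex.add_re, Complex.add_im, Complex.mul_re, Complex.mul_im, Complex.neg_re, Complex.neg_im,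
    Complex.I_re, Complex.I_im, Complex.one_re, Complex.one_im, neg_zero, zero_mul, one_mul, zero_sub,
    zero_add, add_zero, neg_mul, neg_neg]
  nlinarith [hζ]

/-- `(iz+1)(-iφ(z)+1) = 2`. [cite: BorceaBranden2009, §6.1 proof of Lemma 6.2 (`ad - bc`)] -/
theorem I_mul_add_one_mul_phi {z : ℂ} (hz : I * z + 1 ≠ 0) :
    (I * z + 1) * (-I * mobius 1 I I 1 z + 1) = 2 := by
  have h : mobius 1 I I 1 z * (I * z + 1) = z + I := by
    rw [mobius_phi]
    exact div_mul_cancel₀ _ hz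
  linear_combination (-I) * h + (-1) * Complex.I_mul_I

/-- `(-iζ+1)(iψ(ζ)+1) = 2`. [cite: BorceaBranden2009, §6.1 proof of Lemma 6.2] -/
theorem neg_I_mul_add_one_mul_psi {ζ : ℂ} (hζ : -I * ζ + 1 ≠ 0) :
    (-I * ζ + 1) * (I * mobius 1 (-I) (-I) 1 ζ + 1) = 2 := by
  have h : mobius 1 (-I) (-I) 1 ζ * (-I * ζ + 1) = ζ + -I := by
    rw [mobius_psi]
    exact div_mul_cancel₀ _ hζ
  linear_combination I * h + (-1) * Complex.I_mul_I

/-- **`ψ ∘ φ = id`** away from the pole of `φ`. [cite: BorceaBranden2009, §6.1 proof of Lemma 6.2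
(`Φ_κ^{-1}`)] -/
theorem mobius_psi_phi {z : ℂ} (hz : I * z + 1 ≠ 0) : mobius 1 (-I) (-I) 1 (mobius 1 I I 1 z) = z := by
  have h : mobius 1 I I 1 z * (I * z + 1) = z + I := by
    rw [mobius_phi]
    exact div_mul_cancel₀ _ hz
  have hden : -I * mobius 1 I I 1 z + 1 ≠ 0 := fun h0 => by
    have h2 := I_mul_add_one_mul_phi hz
    rw [h0, mul_zero] at h2
    exact two_ne_zero h2.symm
  rw [mobius_psi, div_eq_iff hden]
  linear_combination h

/-- **`φ ∘ ψ = id`** away from the pole of `ψ`. [cite: BorceaBranden2009, §6.1 proof of Lemma 6.2] -/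
theorem mobius_phi_psi {ζ : ℂ} (hζ : -I * ζ + 1 ≠ 0) : mobius 1 I I 1 (mobius 1 (-I) (-I) 1 ζ) = ζ := by
  have h : mobius 1 (-I) (-I) 1 ζ * (-I * ζ + 1) = ζ + -I := by
    rw [mobius_psi]
    exact div_mul_cancel₀ _ hζ
  have hden : I * mobius 1 (-I) (-I) 1 ζ + 1 ≠ 0 := fun h0 => by
    have h2 := neg_I_mul_add_one_mul_psi hζ
    rw [h0, mul_zero] at h2
    exact two_ne_zero h2.symm
  rw [mobius_phi, div_eq_iff hden]
  linear_combination h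

/-- `(i + ω) ψ(ω) = 1 + iω`: the slope of `(z+i) + ω(iz+1)` as a multiple of its constant term.
[cite: BorceaBranden2009, §6.1 Remark 6.1 ("a constant multiple of `T[(1+zw)^κ]`")] -/
theorem I_add_mul_psi {ω : ℂ} (hω : -I * ω + 1 ≠ 0) : (I + ω) * mobius 1 (-I) (-I) 1 ω = 1 + I * ω := by
  have h : mobius 1 (-I) (-I) 1 ω * (-I * ω + 1) = ω + -I := by
    rw [mobius_psi]
    exact div_mul_cancel₀ _ hω
  linear_combination I * h + (ω * mobius 1 (-I) (-I) 1 ω - 1) * Complex.I_mul_I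

/-- `i + ω ≠ 0` for `ω ∈ H`. [cite: BorceaBranden2009, §6.1] -/
theorem I_add_ne_zero {ω : ℂ} (hω : 0 < ω.im) : I + ω ≠ 0 := fun h => by
  have h' := congrArg Complex.im h
  simp only [Complex.add_im, Complex.I_im, Complex.zero_im] at h'
  linarith

end Mobius

/-! ## §3 The Möbius substitution `Φ_κ` -/

section Subst

variable {τ : Type*} [Fintype τ] [DecidableEq τ]

/-- `Φ_κ(z^m) = Π_i (a z_i + b)^{m_i} (c z_i + d)^{κ_i - m_i}` (`m ≤ κ`). [cite: BorceaBranden2009, §6.1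
eq. (6.3)] -/
def mobiusTerm (κ : τ → ℕ) (a b c d : ℂ) (m : τ → ℕ) : MvPolynomial τ ℂ :=
  ∏ i, (C a * X i + C b) ^ m i * (C c * X i + C d) ^ (κ i - m i)

/-- **The Möbius substitution `Φ_κ(f)(z) = Π_i (c z_i + d)^{κ_i} f(φ(z_1),…,φ(z_n))`, `φ(ζ) = (aζ+b)/(cζ+d)`**,
as the `ℂ`-linear map sending `z^m ↦ Π_i (a z_i + b)^{m_i} (c z_i + d)^{κ_i - m_i}` (this is `Φ_κ` on `ℂ_κ[z]`,
see `eval_mobiusSubst`; here one Möbius map serves all variables). [cite: BorceaBranden2009, §6.1 eq. (6.3)] -/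
def mobiusSubst (κ : τ → ℕ) (a b c d : ℂ) : MvPolynomial τ ℂ →ₗ[ℂ] MvPolynomial τ ℂ :=
  (basisMonomials τ ℂ).constr ℂ fun s => mobiusTerm κ a b c d ⇑s

variable (κ : τ → ℕ) (a b c d : ℂ)

omit [DecidableEq τ] in
/-- `Φ_κ` on monomials. [cite: BorceaBranden2009, §6.1 eq. (6.3)] -/
theorem mobiusSubst_monomial (s : τ →₀ ℕ) (r : ℂ) :
    mobiusSubst κ a b c d (monomial s r) = r • mobiusTerm κ a b c d ⇑s := by
  have h : (monomial s r : MvPolynomial τ ℂ) = r • basisMonomials τ ℂ s := by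
    rw [coe_basisMonomials, smul_monomial, smul_eq_mul, mul_one]
  rw [h, map_smul, mobiusSubst, Module.Basis.constr_basis]

omit [DecidableEq τ] in
/-- `Φ_κ(z^m)`. [cite: BorceaBranden2009, §6.1 eq. (6.3)] -/
theorem mobiusSubst_prod_X_pow (m : τ → ℕ) :
    mobiusSubst κ a b c d (∏ i, X i ^ m i) = mobiusTerm κ a b c d m := by
  have hm : ⇑(toF m) = m := funext (toF_apply m)
  rw [prod_X_pow_eq_monomial_toF, mobiusSubst_monomial, one_smul, hm]

/-- `Φ_κ(f) = Σ_{m ≤ κ} a_m Φ_κ(z^m)` for `f = Σ a_m z^m ∈ ℂ_κ[z]`. [cite: BorceaBranden2009, §6.1 eq. (6.3)] -/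
theorem mobiusSubst_eq_sum_box {p : MvPolynomial τ ℂ} (hp : ∀ i, degreeOf i p ≤ κ i) :
    mobiusSubst κ a b c d p =
      ∑ m ∈ Fintype.piFinset (fun i => range (κ i + 1)), coeff (toF m) p • mobiusTerm κ a b c d m := by
  conv_lhs => rw [eq_sum_box hp]
  rw [map_sum]
  refine sum_congr rfl fun m _ => ?_
  rw [map_smul, mobiusSubst_prod_X_pow]

omit [Fintype τ] in
/-- `deg_{z_i}(a z_j + b) ≤ [i = j]`. [cite: BorceaBranden2009, §6.1] -/
theorem degreeOf_C_mul_X_add_C_le (i j : τ) :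
    degreeOf i (C a * X j + C b : MvPolynomial τ ℂ) ≤ if i = j then 1 else 0 := by
  refine (degreeOf_add_le _ _ _).trans (max_le ((degreeOf_C_mul_le _ _ _).trans (degreeOf_X i j).le) ?_)
  rw [degreeOf_C]
  exact Nat.zero_le _

/-- `deg_{z_i} Φ_κ(z^m) ≤ κ_i` for `m_i ≤ κ_i`. [cite: BorceaBranden2009, §6.1 ("`Φ_κ : ℂ_κ[z] → ℂ_κ[z]`")] -/
theorem degreeOf_mobiusTerm_le {m : τ → ℕ} (i : τ) (hm : m i ≤ κ i) :
    degreeOf i (mobiusTerm κ a b c d m) ≤ κ i := by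
  rw [mobiusTerm]
  refine (degreeOf_prod_le _ _ _).trans ?_
  calc ∑ j, degreeOf i ((C a * X j + C b) ^ m j * (C c * X j + C d) ^ (κ j - m j) : MvPolynomial τ ℂ)
      ≤ ∑ j, (if i = j then κ i else 0) := sum_le_sum fun j _ => ?_
    _ = κ i := by rw [sum_ite_eq, if_pos (mem_univ _)]
  refine (degreeOf_mul_le _ _ _).trans ?_
  refine (add_le_add ((degreeOf_pow_le _ _ _).trans (Nat.mul_le_mul_left _ (degreeOf_C_mul_X_add_C_le a b i j)))
    ((degreeOf_pow_le _ _ _).trans (Nat.mul_le_mul_left _ (degreeOf_C_mul_X_add_C_le c d i j)))).trans ?_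
  split_ifs with h
  · subst h
    rw [mul_one, mul_one, Nat.add_sub_cancel' hm]
  · simp

/-- **`Φ_κ` maps `ℂ_κ[z]` to `ℂ_κ[z]`.** [cite: BorceaBranden2009, §6.1 Lemma 6.2
("`Φ_κ : ℂ_κ[z_1,…,z_n] → ℂ_κ[z_1,…,z_n]`")] -/
theorem degreeOf_mobiusSubst_le {p : MvPolynomial τ ℂ} (hp : ∀ i, degreeOf i p ≤ κ i) (i : τ) :
    degreeOf i (mobiusSubst κ a b c d p) ≤ κ i := by
  rw [mobiusSubst_eq_sum_box κ a b c d hp]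
  refine (degreeOf_sum_le _ _ _).trans (Finset.sup_le fun m hm => ?_)
  rw [smul_eq_C_mul]
  exact (degreeOf_C_mul_le _ _ _).trans (degreeOf_mobiusTerm_le κ a b c d i (mem_box_iff.1 hm i))

omit [DecidableEq τ] in
/-- `Φ_κ(z^m)(z) = Π_i (c z_i + d)^{κ_i} φ(z_i)^{m_i}` where `c z_i + d ≠ 0`. [cite: BorceaBranden2009, §6.1
eq. (6.3)] -/
theorem eval_mobiusTerm {m : τ → ℕ} (hm : ∀ i, m i ≤ κ i) {z : τ → ℂ} (hz : ∀ i, c * z i + d ≠ 0) :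
    eval z (mobiusTerm κ a b c d m) = (∏ i, (c * z i + d) ^ κ i) * ∏ i, mobius a b c d (z i) ^ m i := by
  rw [mobiusTerm, _root_.map_prod, ← prod_mul_distrib]
  refine prod_congr rfl fun i _ => ?_
  simp only [_root_.map_mul, _root_.map_pow, _root_.map_add, eval_C, eval_X]
  obtain ⟨e, he⟩ := Nat.exists_eq_add_of_le (hm i)
  have hzi := hz i
  rw [he, Nat.add_sub_cancel_left, pow_add, mobius, div_pow, mul_assoc, mul_comm ((c * z i + d) ^ e),
    ← mul_assoc, mul_div_cancel₀ _ (pow_ne_zero _ hzi)]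

/-- **(6.3): `Φ_κ(f)(z) = Π_i (c z_i + d)^{κ_i} · f(φ(z_1),…,φ(z_n))`** for `f ∈ ℂ_κ[z]` and `c z_i + d ≠ 0`.
[cite: BorceaBranden2009, §6.1 eq. (6.3)] -/
theorem eval_mobiusSubst {p : MvPolynomial τ ℂ} (hp : ∀ i, degreeOf i p ≤ κ i) {z : τ → ℂ}
    (hz : ∀ i, c * z i + d ≠ 0) :
    eval z (mobiusSubst κ a b c d p) = (∏ i, (c * z i + d) ^ κ i) * eval (fun i => mobius a b c d (z i)) p := by
  rw [mobiusSubst_eq_sum_box κ a b c d hp, map_sum]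
  conv_rhs => rw [eq_sum_box hp, map_sum, mul_sum]
  refine sum_congr rfl fun m hm => ?_
  rw [smul_eval, smul_eval, eval_mobiusTerm κ a b c d (mem_box_iff.1 hm) hz, _root_.map_prod]
  simp only [map_pow, eval_X]
  ring

/-- **`Φ_κ[(z+w)^κ] = Π_i ((a z_i + b) + w_i (c z_i + d))^{κ_i}`** (binomial theorem).
[cite: BorceaBranden2009, §6.1 proof of Thm 6.3 ("`Φ_{κ⊕κ}((z+w)^κ)`")] -/
theorem mobiusSubst_prod_X_add_C_pow (w : τ → ℂ) :
    mobiusSubst κ a b c d (∏ i, (X i + C (w i)) ^ κ i) =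
      ∏ i, ((C a * X i + C b) + C (w i) * (C c * X i + C d)) ^ κ i := by
  rw [apply_prod_X_add_C_pow κ _ w]
  simp_rw [mobiusSubst_prod_X_pow]
  symm
  have h1 : (∏ i, ((C a * X i + C b) + C (w i) * (C c * X i + C d)) ^ κ i : MvPolynomial τ ℂ) =
      ∏ i, ∑ k ∈ range (κ i + 1), (C a * X i + C b) ^ k * (C (w i) * (C c * X i + C d)) ^ (κ i - k) *
        ((κ i).choose k : MvPolynomial τ ℂ) :=
    prod_congr rfl fun i _ => add_pow _ _ _
  rw [h1, prod_univ_sum]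
  refine sum_congr rfl fun α _ => ?_
  rw [mobiusTerm, smul_eq_C_mul, _root_.map_prod C, ← prod_mul_distrib]
  refine prod_congr rfl fun i _ => ?_
  simp only [_root_.map_mul, map_pow, map_natCast, mul_pow]
  ring

/-- **`Φ_φ ∘ Φ_ψ = 2^{|κ|} · id` on `ℂ_κ[z]`** for `φ(z) = (z+i)/(iz+1)`, `ψ(ζ) = (ζ-i)/(-iζ+1)` (the two
substitutions are mutually inverse up to the constant `(ad-bc)^{|κ|} = 2^{|κ|}`; polynomial identity from the
pointwise one on the infinite box `(ℂ ∖ {i})ⁿ`). [cite: BorceaBranden2009, §6.1 proof of Lemma 6.2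
(`Φ_κ^{-1}(g) = (-c z_1 + a)^{κ_1} g((d z_1 - b)/(-c z_1 + a), …)`)] -/
theorem mobiusSubst_phi_psi {p : MvPolynomial τ ℂ} (hp : ∀ i, degreeOf i p ≤ κ i) :
    mobiusSubst κ 1 I I 1 (mobiusSubst κ 1 (-I) (-I) 1 p) = (2 : ℂ) ^ (∑ i, κ i) • p := by
  refine MvPolynomial.funext_set (fun _ => ({I}ᶜ : Set ℂ)) (fun _ => (Set.finite_singleton I).infinite_compl)
    fun x hx => ?_
  have hxI : ∀ i, x i ≠ I := fun i => Set.mem_compl_singleton_iff.1 (hx i (Set.mem_univ i))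
  have h1 : ∀ i, I * x i + 1 ≠ 0 := fun i => I_mul_add_one_ne_zero (hxI i)
  have h2 : ∀ i, -I * mobius 1 I I 1 (x i) + 1 ≠ 0 := fun i h0 => by
    have h3 := I_mul_add_one_mul_phi (h1 i)
    rw [h0, mul_zero] at h3
    exact two_ne_zero h3.symm
  rw [eval_mobiusSubst κ 1 I I 1 (degreeOf_mobiusSubst_le κ 1 (-I) (-I) 1 hp) h1,
    eval_mobiusSubst κ 1 (-I) (-I) 1 hp h2, smul_eval, ← mul_assoc, ← prod_mul_distrib]
  have h4 : (fun i => mobius 1 (-I) (-I) 1 (mobius 1 I I 1 (x i))) = x := funext fun i => mobius_psi_phi (h1 i)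
  rw [h4]
  congr 1
  rw [← prod_pow_eq_pow_sum]
  refine prod_congr rfl fun i _ => ?_
  rw [← mul_pow, I_mul_add_one_mul_phi (h1 i)]

end Subst

/-! ## §4 Lemma 6.2 for `𝔻ⁿ ↔ Hⁿ` -/

section Translate

variable {τ : Type*} [Fintype τ] [DecidableEq τ] (κ : τ → ℕ)

/-- **Lemma 6.2 (`Hⁿ → 𝔻ⁿ`)**: for stable `f ∈ ℂ_κ[z]`, `Φ_κ(f)(z) = Π (i z_i + 1)^{κ_i} f(φ(z))` is
`𝔻`-stable. [cite: BorceaBranden2009, §6.1 Lemma 6.2] -/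
theorem IsUpperHalfPlaneStable.isDiskStable_mobiusSubst {f : MvPolynomial τ ℂ} (hf : IsUpperHalfPlaneStable f)
    (hκ : ∀ i, degreeOf i f ≤ κ i) : IsDiskStable (mobiusSubst κ 1 I I 1 f) := by
  intro z hz
  have h1 : ∀ i, I * z i + 1 ≠ 0 := fun i => I_mul_add_one_ne_zero (ne_I_of_norm_lt_one (hz i))
  rw [eval_mobiusSubst κ 1 I I 1 hκ h1]
  exact mul_ne_zero (prod_ne_zero_iff.2 fun i _ => pow_ne_zero _ (h1 i))
    (hf _ fun i => im_mobius_phi_pos (hz i))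

/-- **Lemma 6.2 (`𝔻ⁿ → Hⁿ`)**: for `𝔻`-stable `g ∈ ℂ_κ[z]`, `Ψ_κ(g)(ζ) = Π (-i ζ_i + 1)^{κ_i} g(ψ(ζ))` is
stable. [cite: BorceaBranden2009, §6.1 Lemma 6.2 (`Φ_κ^{-1}`)] -/
theorem IsDiskStable.isUpperHalfPlaneStable_mobiusSubst {g : MvPolynomial τ ℂ} (hg : IsDiskStable g)
    (hκ : ∀ i, degreeOf i g ≤ κ i) : IsUpperHalfPlaneStable (mobiusSubst κ 1 (-I) (-I) 1 g) := by
  intro ζ hζ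
  have h1 : ∀ i, -I * ζ i + 1 ≠ 0 := fun i => neg_I_mul_add_one_ne_zero (hζ i)
  rw [eval_mobiusSubst κ 1 (-I) (-I) 1 hκ h1]
  exact mul_ne_zero (prod_ne_zero_iff.2 fun i _ => pow_ne_zero _ (h1 i))
    (hg _ fun i => norm_mobius_psi_lt_one (hζ i))

/-- **Lemma 6.2 for `𝔻ⁿ`, as printed (bijection)**: a polynomial `g ∈ ℂ_κ[z]` is `𝔻`-stable iff it is
`Φ_κ(f)` for a stable `f ∈ ℂ_κ[z]` (up to the harmless constant `2^{|κ|}`). [cite: BorceaBranden2009, §6.1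
Lemma 6.2] -/
theorem isDiskStable_iff_exists_mobiusSubst {g : MvPolynomial τ ℂ} (hκ : ∀ i, degreeOf i g ≤ κ i) :
    IsDiskStable g ↔ ∃ f : MvPolynomial τ ℂ, (∀ i, degreeOf i f ≤ κ i) ∧ IsUpperHalfPlaneStable f ∧
      mobiusSubst κ 1 I I 1 f = (2 : ℂ) ^ (∑ i, κ i) • g := by
  constructor
  · intro hg
    exact ⟨_, degreeOf_mobiusSubst_le κ 1 (-I) (-I) 1 hκ, hg.isUpperHalfPlaneStable_mobiusSubst κ hκ,
      mobiusSubst_phi_psi κ hκ⟩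
  · rintro ⟨f, hf, hfs, hfg⟩
    rw [← isDiskStable_smul_iff (pow_ne_zero _ (two_ne_zero (α := ℂ))), ← hfg]
    exact hfs.isDiskStable_mobiusSubst κ hf

end Translate

/-! ## §5 Theorem 3.2 for `C = 𝔻` -/

section DiskTheorem

variable {τ : Type*} [Fintype τ] [DecidableEq τ]

/-- **A degree bound `γ` with `T(ℂ_κ[z]) ⊆ ℂ_γ[z]`** (`ℂ_κ[z]` is finite dimensional).
[cite: BorceaBranden2009, §6.1 proof of Thm 6.3 ("`γ ∈ ℕⁿ` be such that `T(ℂ_κ[z]) ⊆ ℂ_γ[z]`")] -/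
def rangeBound (κ : τ → ℕ) (T : MvPolynomial τ ℂ →ₗ[ℂ] MvPolynomial τ ℂ) : τ → ℕ :=
  fun i => (Fintype.piFinset fun j => range (κ j + 1)).sup fun m => degreeOf i (T (∏ j, X j ^ m j))

/-- `T(z^m) ∈ ℂ_γ[z]` for `m ≤ κ`, `γ = rangeBound κ T`. [cite: BorceaBranden2009, §6.1 proof of Thm 6.3] -/
theorem degreeOf_apply_prod_X_pow_le_rangeBound (κ : τ → ℕ) (T : MvPolynomial τ ℂ →ₗ[ℂ] MvPolynomial τ ℂ)
    {m : τ → ℕ} (hm : m ∈ Fintype.piFinset fun j => range (κ j + 1)) (i : τ) :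
    degreeOf i (T (∏ j, X j ^ m j)) ≤ rangeBound κ T i :=
  Finset.le_sup (f := fun m : τ → ℕ => degreeOf i (T (∏ j, X j ^ m j))) hm

/-- `T(ℂ_κ[z]) ⊆ ℂ_γ[z]` for `γ = rangeBound κ T`. [cite: BorceaBranden2009, §6.1 proof of Thm 6.3] -/
theorem degreeOf_apply_le_rangeBound (κ : τ → ℕ) (T : MvPolynomial τ ℂ →ₗ[ℂ] MvPolynomial τ ℂ)
    {p : MvPolynomial τ ℂ} (hp : ∀ i, degreeOf i p ≤ κ i) (i : τ) :
    degreeOf i (T p) ≤ rangeBound κ T i := by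
  have h2 : T p = ∑ m ∈ Fintype.piFinset (fun i => range (κ i + 1)),
      C (coeff (toF m) p) * T (∏ j, X j ^ m j) := by
    conv_lhs => rw [eq_sum_box hp]
    rw [map_sum]
    exact sum_congr rfl fun m _ => by rw [map_smul, smul_eq_C_mul]
  rw [h2]
  refine (degreeOf_sum_le _ _ _).trans (Finset.sup_le fun m hm => ?_)
  exact (degreeOf_C_mul_le _ _ _).trans (degreeOf_apply_prod_X_pow_le_rangeBound κ T hm i)

/-- `deg_{z_i} Π_j (z_j + w_j)^{κ_j} ≤ κ_i`. [cite: BorceaBranden2009, §1.1 (`(z+w)^κ ∈ ℂ_κ[z]`)] -/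
theorem degreeOf_prod_X_add_C_pow_le (κ : τ → ℕ) (w : τ → ℂ) (i : τ) :
    degreeOf i (∏ j, (X j + C (w j)) ^ κ j : MvPolynomial τ ℂ) ≤ κ i := by
  refine (degreeOf_prod_le _ _ _).trans ?_
  calc ∑ j, degreeOf i ((X j + C (w j)) ^ κ j : MvPolynomial τ ℂ)
      ≤ ∑ j, (if i = j then κ i else 0) := sum_le_sum fun j _ => ?_
    _ = κ i := by rw [sum_ite_eq, if_pos (mem_univ _)]
  have h1 : degreeOf i (X j + C (w j) : MvPolynomial τ ℂ) ≤ if i = j then 1 else 0 := by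
    have h2 := degreeOf_C_mul_X_add_C_le (1 : ℂ) (w j) i j
    rwa [C_1, one_mul] at h2
  refine ((degreeOf_pow_le _ _ _).trans (Nat.mul_le_mul_left _ h1)).trans ?_
  split_ifs with h
  · subst h
    rw [mul_one]
  · simp

/-- `T[(1+zw)^κ]` is `𝔻`-stable iff `T[Π (1 + w_i z_i)^{κ_i}](z) ≠ 0` for `z, w ∈ 𝔻ⁿ`.
[cite: BorceaBranden2009II, §3 Thm 3.2 (b)] -/
theorem isDiskStable_boundedDegreeSymbolD_iff (κ : τ → ℕ) (T : MvPolynomial τ ℂ →ₗ[ℂ] MvPolynomial τ ℂ) :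
    IsDiskStable (boundedDegreeSymbolD κ T) ↔
      ∀ z w : τ → ℂ, (∀ i, ‖z i‖ < 1) → (∀ i, ‖w i‖ < 1) →
        eval z (T (∏ i, (1 + C (w i) * X i) ^ κ i)) ≠ 0 := by
  constructor
  · intro h z w hz hw
    have h' := h (Sum.elim z w) fun j => by
      rcases j with i | i
      · simpa only [Sum.elim_inl] using hz i
      · simpa only [Sum.elim_inr] using hw i
    rwa [eval_boundedDegreeSymbolD] at h'
  · intro h zw hzw
    rw [← Sum.elim_comp_inl_inr zw, eval_boundedDegreeSymbolD]
    exact h _ _ (fun i => hzw (Sum.inl i)) fun i => hzw (Sum.inr i)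

/-- **`Φ_κ[(z+w)^κ] = Π_i (i + w_i)^{κ_i} · Π_i (1 + ψ(w_i) z_i)^{κ_i}`** for `w ∈ Hⁿ` — the identity behind
Remark 6.1 ("this symbol becomes a constant multiple of `T[(1+zw)^κ]`"). [cite: BorceaBranden2009, §6.1
Remark 6.1] -/
theorem mobiusSubst_phi_prod_X_add_C_pow (κ : τ → ℕ) {w : τ → ℂ} (hw : ∀ i, -I * w i + 1 ≠ 0) :
    mobiusSubst κ 1 I I 1 (∏ i, (X i + C (w i)) ^ κ i) =
      C (∏ i, (I + w i) ^ κ i) * ∏ i, (1 + C (mobius 1 (-I) (-I) 1 (w i)) * X i) ^ κ i := by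
  rw [mobiusSubst_prod_X_add_C_pow, _root_.map_prod C, ← prod_mul_distrib]
  refine prod_congr rfl fun i _ => ?_
  rw [C_pow, ← mul_pow]
  congr 1
  have h := I_add_mul_psi (hw i)
  have h' : C (I + w i) * (1 + C (mobius 1 (-I) (-I) 1 (w i)) * X i) =
      C (I + w i) + C ((I + w i) * mobius 1 (-I) (-I) 1 (w i)) * (X i : MvPolynomial τ ℂ) := by
    rw [_root_.map_mul]
    ring
  rw [h', h, map_add, map_add, _root_.map_mul, C_1]
  ring

/-- **Borcea–Brändén II, Theorem 3.2, `C = 𝔻` (every `κ ∈ ℕⁿ`)** — equivalently part I, Theorem 6.3 with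
`C_1 = ⋯ = C_n = 𝔻`. A linear operator `T` on `ℂ[z_τ]` maps every `𝔻`-stable polynomial of `ℂ_κ[z_τ]`
(degree `≤ κ_i` in `z_i`) to a `𝔻`-stable polynomial or to `0` iff either (a) `T = α(·)P` on `ℂ_κ[z_τ]` for a
linear functional `α` and a `𝔻`-stable `P`, or (b) `T[(1+zw)^κ] = Σ_{α≤κ} binom(κ,α) T(z^α) w^α` is
`𝔻`-stable (in `2n` variables). Proof as in part I: conjugate by the Möbius substitutions of Lemma 6.2 and apply
Theorem 1.1 for `Hⁿ`. [cite: BorceaBranden2009II, §3 Thm 3.2] [cite: BorceaBranden2009, §6.1 Thm 6.3,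
Remark 6.1] -/
theorem BorceaBranden_diskStabilityPreserver_iff (κ : τ → ℕ) (T : MvPolynomial τ ℂ →ₗ[ℂ] MvPolynomial τ ℂ) :
    (∀ p : MvPolynomial τ ℂ, (∀ i, degreeOf i p ≤ κ i) → IsDiskStable p → IsDiskStable (T p) ∨ T p = 0) ↔
      ((∃ (α : MvPolynomial τ ℂ →ₗ[ℂ] ℂ) (P : MvPolynomial τ ℂ), IsDiskStable P ∧
          ∀ p : MvPolynomial τ ℂ, (∀ i, degreeOf i p ≤ κ i) → T p = α p • P) ∨
        IsDiskStable (boundedDegreeSymbolD κ T)) := by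
  -- notation: `Φδ = Φ_δ` for `φ` (`H`-stable ↦ `𝔻`-stable), `Ψδ = Φ_δ` for `ψ` (`𝔻`-stable ↦ `H`-stable)
  set γ : τ → ℕ := rangeBound κ T with hγ
  set Φκ : MvPolynomial τ ℂ →ₗ[ℂ] MvPolynomial τ ℂ := mobiusSubst κ 1 I I 1 with hΦκ
  set Ψκ : MvPolynomial τ ℂ →ₗ[ℂ] MvPolynomial τ ℂ := mobiusSubst κ 1 (-I) (-I) 1 with hΨκ
  set Φγ : MvPolynomial τ ℂ →ₗ[ℂ] MvPolynomial τ ℂ := mobiusSubst γ 1 I I 1 with hΦγ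
  set Ψγ : MvPolynomial τ ℂ →ₗ[ℂ] MvPolynomial τ ℂ := mobiusSubst γ 1 (-I) (-I) 1 with hΨγ
  set T' : MvPolynomial τ ℂ →ₗ[ℂ] MvPolynomial τ ℂ := Ψγ ∘ₗ T ∘ₗ Φκ with hT'
  have hT'app : ∀ q, T' q = Ψγ (T (Φκ q)) := fun q => rfl
  have h2κ : ((2 : ℂ) ^ ∑ i, κ i) ≠ 0 := pow_ne_zero _ two_ne_zero
  have h2γ : ((2 : ℂ) ^ ∑ i, γ i) ≠ 0 := pow_ne_zero _ two_ne_zero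
  -- degrees
  have hdΦκ : ∀ q : MvPolynomial τ ℂ, (∀ i, degreeOf i q ≤ κ i) → ∀ i, degreeOf i (Φκ q) ≤ κ i :=
    fun q hq => degreeOf_mobiusSubst_le κ 1 I I 1 hq
  have hdΨκ : ∀ q : MvPolynomial τ ℂ, (∀ i, degreeOf i q ≤ κ i) → ∀ i, degreeOf i (Ψκ q) ≤ κ i :=
    fun q hq => degreeOf_mobiusSubst_le κ 1 (-I) (-I) 1 hq
  have hdT : ∀ q : MvPolynomial τ ℂ, (∀ i, degreeOf i q ≤ κ i) → ∀ i, degreeOf i (T q) ≤ γ i :=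
    fun q hq => degreeOf_apply_le_rangeBound κ T hq
  have hdΨγ : ∀ q : MvPolynomial τ ℂ, (∀ i, degreeOf i q ≤ γ i) → ∀ i, degreeOf i (Ψγ q) ≤ γ i :=
    fun q hq => degreeOf_mobiusSubst_le γ 1 (-I) (-I) 1 hq
  -- the two inverse relations
  have hinvκ : ∀ q : MvPolynomial τ ℂ, (∀ i, degreeOf i q ≤ κ i) → Φκ (Ψκ q) = (2 : ℂ) ^ (∑ i, κ i) • q :=
    fun q hq => mobiusSubst_phi_psi κ hq
  have hinvγ : ∀ q : MvPolynomial τ ℂ, (∀ i, degreeOf i q ≤ γ i) → Φγ (Ψγ q) = (2 : ℂ) ^ (∑ i, γ i) • q :=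
    fun q hq => mobiusSubst_phi_psi γ hq
  -- `T'(Ψκ g) = 2^{|κ|} Ψγ (T g)` on `ℂ_κ`
  have hT'Ψ : ∀ g : MvPolynomial τ ℂ, (∀ i, degreeOf i g ≤ κ i) →
      T' (Ψκ g) = (2 : ℂ) ^ (∑ i, κ i) • Ψγ (T g) := by
    intro g hg
    rw [hT'app, hinvκ g hg, map_smul, map_smul]
  -- `Ψγ (T g) = 0 ⇒ T g = 0` on `ℂ_κ`
  have hΨγ0 : ∀ g : MvPolynomial τ ℂ, (∀ i, degreeOf i g ≤ κ i) → Ψγ (T g) = 0 → T g = 0 := by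
    intro g hg h0
    have h1 := hinvγ (T g) (hdT g hg)
    rw [h0, map_zero] at h1
    exact (smul_eq_zero.1 h1.symm).resolve_left h2γ
  -- (1) preservation
  have hpres : (∀ p : MvPolynomial τ ℂ, (∀ i, degreeOf i p ≤ κ i) → IsDiskStable p →
      IsDiskStable (T p) ∨ T p = 0) ↔
      ∀ p : MvPolynomial τ ℂ, (∀ i, degreeOf i p ≤ κ i) → IsUpperHalfPlaneStable p →
        IsUpperHalfPlaneStable (T' p) ∨ T' p = 0 := by
    constructor
    · intro h f hf hfs
      rw [hT'app]
      rcases h (Φκ f) (hdΦκ f hf) (hfs.isDiskStable_mobiusSubst κ hf) with h1 | h1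
      · exact Or.inl (h1.isUpperHalfPlaneStable_mobiusSubst γ (hdT _ (hdΦκ f hf)))
      · exact Or.inr (by rw [h1, map_zero])
    · intro h g hg hgs
      rcases h (Ψκ g) (hdΨκ g hg) (hgs.isUpperHalfPlaneStable_mobiusSubst κ hg) with h1 | h1
      · left
        rw [hT'Ψ g hg, isUpperHalfPlaneStable_smul_iff h2κ] at h1
        have h3 := h1.isDiskStable_mobiusSubst γ (hdΨγ _ (hdT g hg))
        rwa [show mobiusSubst γ 1 I I 1 (Ψγ (T g)) = Φγ (Ψγ (T g)) from rfl, hinvγ (T g) (hdT g hg),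
          isDiskStable_smul_iff h2γ] at h3
      · right
        rw [hT'Ψ g hg] at h1
        exact hΨγ0 g hg ((smul_eq_zero.1 h1).resolve_left h2κ)
  -- (2) rank one
  have hrank : (∃ (α : MvPolynomial τ ℂ →ₗ[ℂ] ℂ) (P : MvPolynomial τ ℂ), IsUpperHalfPlaneStable P ∧
        ∀ p : MvPolynomial τ ℂ, (∀ i, degreeOf i p ≤ κ i) → T' p = α p • P) ↔
      ∃ (α : MvPolynomial τ ℂ →ₗ[ℂ] ℂ) (P : MvPolynomial τ ℂ), IsDiskStable P ∧
        ∀ p : MvPolynomial τ ℂ, (∀ i, degreeOf i p ≤ κ i) → T p = α p • P := by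
    constructor
    · rintro ⟨α, P, hP, h⟩
      by_cases hα : ∃ f : MvPolynomial τ ℂ, (∀ i, degreeOf i f ≤ κ i) ∧ α f ≠ 0
      · obtain ⟨f₀, hf₀, hα₀⟩ := hα
        -- `P ∈ ℂ_γ`
        have hPdeg : ∀ i, degreeOf i P ≤ γ i := by
          have hP' : P = (α f₀)⁻¹ • T' f₀ := by
            rw [h f₀ hf₀, smul_smul, inv_mul_cancel₀ hα₀, one_smul]
          intro i
          rw [hP', smul_eq_C_mul]
          exact (degreeOf_C_mul_le _ _ _).trans (hdΨγ _ (hdT _ (hdΦκ f₀ hf₀)) i)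
        refine ⟨((2 : ℂ) ^ (∑ i, κ i) * (2 : ℂ) ^ (∑ i, γ i))⁻¹ • (α ∘ₗ Ψκ), Φγ P,
          hP.isDiskStable_mobiusSubst γ hPdeg, fun g hg => ?_⟩
        have h1 : T' (Ψκ g) = α (Ψκ g) • P := h (Ψκ g) (hdΨκ g hg)
        rw [hT'Ψ g hg] at h1
        -- apply `Φγ`
        have h3 := congrArg Φγ h1
        rw [map_smul, map_smul, hinvγ (T g) (hdT g hg), smul_smul] at h3
        rw [LinearMap.smul_apply, LinearMap.comp_apply, smul_eq_mul, mul_smul, ← h3, smul_smul,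
          inv_mul_cancel₀ (mul_ne_zero h2κ h2γ), one_smul]
      · push Not at hα
        refine ⟨0, C 1, isDiskStable_C one_ne_zero, fun g hg => ?_⟩
        rw [LinearMap.zero_apply, zero_smul]
        have h1 : T' (Ψκ g) = 0 := by rw [h (Ψκ g) (hdΨκ g hg), hα (Ψκ g) (hdΨκ g hg), zero_smul]
        rw [hT'Ψ g hg] at h1
        exact hΨγ0 g hg ((smul_eq_zero.1 h1).resolve_left h2κ)
    · rintro ⟨β, Q, hQ, h⟩
      by_cases hβ : ∃ g : MvPolynomial τ ℂ, (∀ i, degreeOf i g ≤ κ i) ∧ β g ≠ 0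
      · obtain ⟨g₀, hg₀, hβ₀⟩ := hβ
        have hQdeg : ∀ i, degreeOf i Q ≤ γ i := by
          have hQ' : Q = (β g₀)⁻¹ • T g₀ := by
            rw [h g₀ hg₀, smul_smul, inv_mul_cancel₀ hβ₀, one_smul]
          intro i
          rw [hQ', smul_eq_C_mul]
          exact (degreeOf_C_mul_le _ _ _).trans (hdT g₀ hg₀ i)
        refine ⟨β ∘ₗ Φκ, Ψγ Q, hQ.isUpperHalfPlaneStable_mobiusSubst γ hQdeg, fun f hf => ?_⟩
        rw [hT'app, h (Φκ f) (hdΦκ f hf), map_smul, LinearMap.comp_apply]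
      · push Not at hβ
        refine ⟨0, C 1, isUpperHalfPlaneStable_C one_ne_zero, fun f hf => ?_⟩
        rw [LinearMap.zero_apply, zero_smul, hT'app, h (Φκ f) (hdΦκ f hf), hβ (Φκ f) (hdΦκ f hf), zero_smul,
          map_zero]
  -- (3) symbols
  have hsymb : IsUpperHalfPlaneStable (boundedDegreeSymbol κ T') ↔ IsDiskStable (boundedDegreeSymbolD κ T) := by
    rw [isUpperHalfPlaneStable_boundedDegreeSymbol_iff, isDiskStable_boundedDegreeSymbolD_iff]
    -- evaluation of `T'[(z+ω)^κ]` at `ζ ∈ Hⁿ`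
    have key : ∀ ζ ω : τ → ℂ, (∀ i, 0 < (ζ i).im) → (∀ i, 0 < (ω i).im) →
        (eval ζ (T' (∏ i, (X i + C (ω i)) ^ κ i)) ≠ 0 ↔
          eval (fun i => mobius 1 (-I) (-I) 1 (ζ i))
            (T (∏ i, (1 + C (mobius 1 (-I) (-I) 1 (ω i)) * X i) ^ κ i)) ≠ 0) := by
      intro ζ ω hζ hω
      have h1 : ∀ i, -I * ζ i + 1 ≠ 0 := fun i => neg_I_mul_add_one_ne_zero (hζ i)
      have h2 : ∀ i, -I * ω i + 1 ≠ 0 := fun i => neg_I_mul_add_one_ne_zero (hω i)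
      have hq : ∀ i, degreeOf i (∏ j, (1 + C (mobius 1 (-I) (-I) 1 (ω j)) * X j) ^ κ j : MvPolynomial τ ℂ)
          ≤ κ i := by
        intro i
        have h3 := hdΦκ _ (degreeOf_prod_X_add_C_pow_le κ ω) i
        rw [show Φκ (∏ j, (X j + C (ω j)) ^ κ j) = mobiusSubst κ 1 I I 1 (∏ j, (X j + C (ω j)) ^ κ j)
          from rfl, mobiusSubst_phi_prod_X_add_C_pow κ h2] at h3
        rwa [degreeOf_C_mul _ _ (mem_nonZeroDivisors_of_ne_zero
          (prod_ne_zero_iff.2 fun j _ => pow_ne_zero _ (I_add_ne_zero (hω j))))] at h3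
      rw [hT'app, show Φκ (∏ i, (X i + C (ω i)) ^ κ i) = mobiusSubst κ 1 I I 1 (∏ i, (X i + C (ω i)) ^ κ i)
        from rfl, mobiusSubst_phi_prod_X_add_C_pow κ h2, ← smul_eq_C_mul, map_smul,
        show Ψγ = mobiusSubst γ 1 (-I) (-I) 1 from rfl, map_smul, smul_eval,
        eval_mobiusSubst γ 1 (-I) (-I) 1 (hdT _ hq) h1, mul_ne_zero_iff, mul_ne_zero_iff]
      exact ⟨fun h => h.2.2, fun h => ⟨prod_ne_zero_iff.2 fun i _ => pow_ne_zero _ (I_add_ne_zero (hω i)),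
        prod_ne_zero_iff.2 fun i _ => pow_ne_zero _ (h1 i), h⟩⟩
    constructor
    · intro h z w hz hw
      have hz1 : ∀ i, I * z i + 1 ≠ 0 := fun i => I_mul_add_one_ne_zero (ne_I_of_norm_lt_one (hz i))
      have hw1 : ∀ i, I * w i + 1 ≠ 0 := fun i => I_mul_add_one_ne_zero (ne_I_of_norm_lt_one (hw i))
      have h1 := (key (fun i => mobius 1 I I 1 (z i)) (fun i => mobius 1 I I 1 (w i))
        (fun i => im_mobius_phi_pos (hz i)) (fun i => im_mobius_phi_pos (hw i))).1
        (h _ _ (fun i => im_mobius_phi_pos (hz i)) fun i => im_mobius_phi_pos (hw i))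
      simp only [mobius_psi_phi (hz1 _), mobius_psi_phi (hw1 _)] at h1
      exact h1
    · intro h ζ ω hζ hω
      exact (key ζ ω hζ hω).2 (h _ _ (fun i => norm_mobius_psi_lt_one (hζ i))
        fun i => norm_mobius_psi_lt_one (hω i))
  rw [hpres, BorceaBranden_stabilityPreserver_iff' κ T', hrank, hsymb]

end DiskTheorem

end Literature.Combinatorics.StablePolynomials

end
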